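import Literature.Topology.FourManifolds.TrisectionFunctorGKPi1Obstruction
import Literature.Topology.FourManifolds.TrisectionCentralSurfacePaths
import Literature.AlgebraicTopology.FundamentalGroup.CircleValuedWindingPerturbation
import Literature.AlgebraicTopology.FundamentalGroup.CircleValuedCrossingLoop
import Mathlib.Geometry.Manifold.Metrizable
import Mathlib.Topology.MetricSpace.HausdorffDistance
import HarnessLib

/-!
# The `π₁`-obstruction to a non-separating reducing curve, from side functions of the three
# compressing discs

Topic `Literature/Topology/FourManifolds`; the assembly of the topological spine of the
`π₁`-shadow of Aranda–Zupan's splitting `X = X′ # (S¹ × S³)` of a trisection with a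
NON-SEPARATING reducing curve (arXiv:2503.04607, §2 p. 6; the named fact
`Literature.Topology.FourManifolds.Trisection.isConnectedSum_circleProd_of_reducing_nonseparating`
of `ReducibleTrisectionSplitting.lean`, whose only use in the tree is `¬ SimplyConnectedSpace X`).
**Everything here is proved; no definitions, no named facts.**

**Theorem (`IsGKTrisection.not_simplyConnectedSpace_of_sideFunctions`).**  Let `S` be a
Gay–Kirby trisection of `X` with central surface `F = ⋂ l, S l` and handlebodies
`H_q = Trisection.spineHandlebody S q`, and let `δ` be a non-separating curve on `F`
(`Trisection.IsCurve`, `Trisection.IsNonSeparating`).  Suppose given, for `q = 0, 1, 2`,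
* a closed set `D_q ⊆ H_q` with `D_q ∩ F = δ` (the compressing disc of `δ` in `H_q`);
* an open `O_q ⊇ D_q` of `X` and a **side function** `σ_q`: at every point of
  `(O_q ∩ H_q) ∖ D_q` it is `±1` and locally constant relative to `H_q`;
* an open `A ⊇ δ` of `X`, inside every `O_q`, on whose trace `(A ∩ F) ∖ δ` each `σ_q` agrees
  with `σ_0` or with `-σ_0` (the two sides of `δ` in `F` fall into opposite sides of every disc);
* a **crossing arc**: a path `α` in `F` inside `A`, meeting `δ` at one interior time `s₀`, with
  `σ_0 = -1` before and `σ_0 = +1` after `s₀`.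
Then `X` is not simply connected.

**Proof** (no tubular neighbourhoods, no homotopy theory).  Metrise `X`
(`Manifold.metrizableSpace`) and put `K_q = σ_q · infDist(·, D_q)`: a continuous normal
coordinate of `D_q` on `O_q ∩ H_q` (it tends to `0` at `D_q` whatever the sides do, and `σ_q` is
locally constant elsewhere).  One cut-off `ρ` on `X` (`exists_cutoff_nhdsSet`), equal to `1` near
`⋃ D_q ∪ α` and supported in the open set `𝒩 = ⋂_q ((X ∖ H_q) ∪ O_q) ∩ ((X ∖ F) ∪ A)`, gives
the three collapses `Θ_q = circleCollapse K_q ρ` on `H_q` (`continuous_circleCollapse`) and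
`c = Θ_0|F`.  The traces `Θ_q|F` are collapses of the normal coordinates `K_q|F` of `δ` in `F`
with the same cut-off, equally or oppositely signed off `δ`, so they are `± c + [D_q]` with `D_q`
real and continuous (`continuous_collapseDiff`) and their winding homomorphisms have the kernel
of `wind ∘ c⁎` (`ker_windingHom_eq_of_eq_add_coe`, `…_neg_…`); each extends over `H_q`, so
`wind ∘ c⁎` kills `K_q = ker (π₁ F → π₁ H_q)` (`ker_inclHomOfSubset_le_ker_windingHom`).  The arc
`α`, closed by a path in the path connected `F ∖ δ`
(`IsGKTrisection.exists_path_diff_of_isNonSeparating`), is a loop of winding number `+1`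
(`windingHom_circleCollapse_ne_one_of_arc_of_path`).  By (T4)
(`IsGKTrisection.not_simplyConnectedSpace_of_hom_spineHandlebody`) `π₁(X) ≠ 1`.

What remains for `Trisection.not_simplyConnectedSpace_of_reducing_nonseparating` (hypotheses
`BoundsDisc S (H_q) δ`, `IsNonSeparating S δ`) is differential topology only: the side functions
of the three smoothly embedded discs near their boundary `δ` and the crossing arc in a chart of
`F` straightening `δ`.

## Programme for the remaining inputs (sketch, NOT proved; review seat 2026-08-17)

The named fact `Trisection.isConnectedSum_circleProd_of_reducing_nonseparating` is frozen as a
record (`ReducibleTrisectionSplitting.lean`, § Review); its operative replacement is the theorem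
above fed with side functions of the three compressing discs `D_q = range d_q`
(`d_q : 𝔻² → X` the `BoundsDisc` witness: a `Manifold.IsSmoothEmbedding (𝓡∂ 2) (𝓡 4) ∞`,
`range d_q ⊆ H_q`, `d_q '' ∂𝔻² = δ`, `range d_q ∩ F = δ`; neatness along `δ` is NOT given).
A road to them, in the order a proof seat would build it:

1. *Flat charts come for free.*  `IsSmoothEmbedding` is Mathlib's `IsImmersion` +
   `IsEmbedding`, and `Manifold.IsImmersionAt` is DEFINED by charts `φ` (maximal atlas of
   `𝓡∂ 2`, resp. `𝓡∂ 3` for the handlebody embedding of clause (iii)) and `ψ` of `X` with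
   `ψ ∘ d_q ∘ (φ.extend _).symm = equiv ∘ (·, 0)` on the half-plane piece `(φ.extend _).target`
   (`Mathlib.Geometry.Manifold.Immersion`, `ImmersionAtProp`): in `ψ` the disc is EXACTLY a
   piece of a linear half-plane, at boundary points too, and `ψ.symm ∘ equiv ∘ (·, 0)` is a
   smooth extension of the sheet across `δ` on an open subset of `ℝ²` — no constant-rank
   theorem, no Seeley extension.
2. *Ambient normal form near `δ`.*  The corner-slice charts of
   `IsGKTrisection.exists_cornerSliceCharts` (`TrisectionsProductStructure.lean`) make `H_q`
   the product of a ray `R_q` of the `(u, v)`-plane with the `F`-plane near every point of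
   `F`: coordinates `(a; s, b)` on `H_q`, `a ≥ 0` along `R_q`, `F = {a = 0}`.  Composing 1.
   with such a chart, near `p ∈ δ` the extended sheet is a smooth immersion
   `G : (open ⊆ ℝ²) → ℝ³ = {(a, s, b)}` (the `u`-type coordinate of the sheet vanishes with
   its derivative along `t ≥ 0`), `G(t ≥ 0) = D_q` near `p` (`d_q` is an embedding), and on
   `t ≥ 0` the height `a ∘ G` vanishes exactly on `t = 0` (`range d_q ∩ F = δ`); nothing is
   known about `G(t < 0)`, which may curl back into `{a ≥ 0}`.
3. *Two overlapping local normal forms along `δ`* (open conditions, together covering `δ`):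
   (V) non-vertical, `(s, b) ∘ G` a local diffeomorphism (always the case when the sheet is
   tangent to `F` at `p`): `D_q` is the graph `{a = g(s, b), (s, b) ∈ Ω̄₊}` over one side of
   the plane curve `δ̄ = (s, b)(δ)`, and `Φ_V = a - ĝ(s, b)` with `ĝ = g ≥ 0` on `Ω̄₊`,
   `ĝ < 0` on `Ω₋` is a defining function: `Φ_V = 0` on `H_q` exactly on `D_q`, and
   `Φ_V|F = -ĝ` changes sign across `δ̄`;  (N) neat, `∂_t (a ∘ G) > 0`: with a vector `e`
   tangent to `F` and transverse to `δ̄`, the map `(s′, t, r) ↦ G(s′, t) + r • e` is a local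
   diffeomorphism (inverse function theorem, `ContDiffAt.toPartialHomeomorph`) in which
   `F = {t = 0}` (`a` is linear and kills `e`, and `a ∘ G` has the sign of `t`), `H_q = {t ≥ 0}`,
   `D_q = {r = 0, t ≥ 0}`, `δ = {r = t = 0}` — a product chart — and `Φ_N = r`.  Interior
   points of the disc — (I): the coordinate `r` of `(w, r) ↦ G(w) + r • n` in the flat chart
   of `H_q` (clause (iii) embedding at an interior point), `n` transverse to the sheet.
4. *Local side functions* `σ = sign Φ` on `(N_p ∩ H_q) ∖ D_q` for each chart of type (V),
   (N), (I); each FLIPS across `D_q`: in a chart box the complement is `{Φ > 0} ⊔ {Φ < 0}`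
   with both pieces connected and both accumulating at every point of `D_q` in the box (so two
   such charts at one point induce the same pair of local sides, possibly swapped).
5. *Coherence over the disc without Čech theory.*  Pull the chart domains back to `𝔻² ⊆ ℝ²`,
   refine to a fine grid of squares (Lebesgue number), assign to each square a chart; for
   squares sharing an edge `e` the product of the two side functions is a constant `ε_e` near
   `d_q(e)` (locally constant and extending across `D_q` at every point of the connected
   `d_q(e)`, because both factors flip); orient the squares row by row and tie the rows along
   the centre column; every other adjacency is then consistent because around a grid vertex the
   four `ε`'s multiply to `1` (evaluate at one complementary point near the vertex).  Shrink
   the chart domains so that only touching squares have meeting domains (`d_q` is injective).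
   This gives `O_q ⊇ D_q` and `σ_q` as required by `not_simplyConnectedSpace_of_sideFunctions`.
6. *Compatibility and crossing.*  The traces `σ_q|F` flip across `δ` (types (V)/(N) at the
   points of `δ`), so `σ_q σ_0` is locally constant along the connected `δ`, hence constant on
   a neighbourhood `A ∩ F` of `δ`: hypothesis `hcomp`.  The crossing arc is a short segment
   transverse to `δ̄` in one chart of type (V) or (N) for `q = 0`, oriented from `σ_0 = -1` to
   `σ_0 = +1`; `hs₀`, `hαneg`, `hαpos` are read off the defining function.
No orientability of `F` or of `H_q` is needed (the disc carries its own coherence), and the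
essentiality hypothesis and the orientation datum of the record play no role
(`IsNonSeparating` enters only through the return path).

## References

* R. Aranda, A. Zupan, *Manifolds with weakly reducible genus-three trisections are standard*,
  arXiv:2503.04607 (2025), §2 p. 6 (non-separating reducing curves). [ArandaZupan2025]
* A. Abrams, D. Gay, R. Kirby, *Group trisections and smooth 4-manifolds*, Geom. Topol. 22
  (2018), p. 1540 (the map `𝒢`). [AbramsGayKirby2018]
* A. Hatcher, *Algebraic Topology*, CUP (2002), Thm. 1.7 (p. 29). [HatcherAT2002]
* J. Milnor, *Topology from the differentiable viewpoint* (1965), §5 (Pontryagin–Thom collapse).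
-/

noncomputable section

open Set Function Filter Topology Metric
open scoped Manifold ContDiff unitInterval

namespace Literature.Topology.FourManifolds

open Literature.AlgebraicTopology.FundamentalGroup

universe u

variable {X : Type u} [TopologicalSpace X] [T2Space X] [SecondCountableTopology X]
  [ChartedSpace (EuclideanSpace ℝ (Fin 4)) X] {g : ℕ} {k : Fin 3 → ℕ} {S : Fin 3 → Set X}

omit [TopologicalSpace X] [T2Space X] [SecondCountableTopology X]
  [ChartedSpace (EuclideanSpace ℝ (Fin 4)) X] in
/-- Two different handlebodies of the spine meet only along the central surface. [folklore] -/
theorem spineHandlebody_inter_spineHandlebody_subset (S : Fin 3 → Set X) {q q' : Fin 3}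
    (hqq' : q ≠ q') :
    Trisection.spineHandlebody S q ∩ Trisection.spineHandlebody S q' ⊆ ⋂ l, S l := by
  rintro y ⟨hy, hy'⟩
  refine mem_iInter.2 fun l => ?_
  by_cases hl : l = q
  · subst hl
    exact Trisection.spineHandlebody_subset S hqq' hy'
  · exact Trisection.spineHandlebody_subset S hl hy

omit [SecondCountableTopology X] in
/-- The handlebodies of the spine of a trisection are closed. [folklore] -/
theorem IsGKTrisection.isClosed_spineHandlebody (h : IsGKTrisection X g k S) (q : Fin 3) :
    IsClosed (Trisection.spineHandlebody S q) :=
  _root_.isClosed_iInter fun l => _root_.isClosed_iInter fun _ => (h.isCompact l).isClosed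

omit [T2Space X] [SecondCountableTopology X] in
/-- A curve on the central surface is non-empty. [folklore] -/
theorem Trisection.IsCurve.nonempty {δ : Set X} (hc : Trisection.IsCurve S δ) : δ.Nonempty := by
  obtain ⟨-, γ, -, hrange⟩ := hc
  rw [← hrange]
  refine (range_nonempty_iff_nonempty.2 ⟨⟨EuclideanSpace.single 0 1, ?_⟩⟩)
  simp

omit [T2Space X] [SecondCountableTopology X] [ChartedSpace (EuclideanSpace ℝ (Fin 4)) X] in
/-- The closure of the support of a restriction lies over the closure of the support.
[folklore] -/
theorem tsupport_comp_subtype_val_subset {T : Set X} (ρ : X → ℝ) :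
    tsupport (ρ ∘ (Subtype.val : T → X)) ⊆ Subtype.val ⁻¹' tsupport ρ :=
  closure_minimal (fun y hy => subset_closure (by simpa using hy))
    ((isClosed_tsupport ρ).preimage continuous_subtype_val)

/-- **The `π₁`-obstruction to a non-separating reducing curve, from side functions of the three
compressing discs.**  See the module docstring for the statement and the proof.
[cite: ArandaZupan2025, §2 p. 6 (reducing curves, non-separating case)]
[cite: AbramsGayKirby2018, p. 1540 (the map 𝒢)] [cite: HatcherAT2002, Thm. 1.7 (p. 29)] -/
theorem IsGKTrisection.not_simplyConnectedSpace_of_sideFunctions (h : IsGKTrisection X g k S)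
    {δ : Set X} (hc : Trisection.IsCurve S δ) (hns : Trisection.IsNonSeparating S δ)
    (D : Fin 3 → Set X) (hDc : ∀ q, IsClosed (D q))
    (hDH : ∀ q, D q ⊆ Trisection.spineHandlebody S q)
    (hDF : ∀ q, D q ∩ (⋂ l, S l) = δ)
    (O : Fin 3 → Set X) (hO : ∀ q, IsOpen (O q)) (hDO : ∀ q, D q ⊆ O q)
    (sd : Fin 3 → X → ℝ)
    (hsd : ∀ q, ∀ y ∈ (O q ∩ Trisection.spineHandlebody S q) \ D q,
      (sd q y = 1 ∨ sd q y = -1) ∧ ∀ᶠ z in 𝓝[Trisection.spineHandlebody S q] y, sd q z = sd q y)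
    (A : Set X) (hA : IsOpen A) (hδA : δ ⊆ A) (hAO : ∀ q, A ⊆ O q)
    (hcomp : ∀ q, (∀ y ∈ (A ∩ ⋂ l, S l) \ δ, sd q y = sd 0 y) ∨
      (∀ y ∈ (A ∩ ⋂ l, S l) \ δ, sd q y = -sd 0 y))
    {a b : ↥(⋂ l, S l)} (α : Path a b) (hαA : ∀ s, (α s : X) ∈ A) (s₀ : I)
    (hs₀ : (0 : ℝ) < s₀ ∧ (s₀ : ℝ) < 1) (hα₀ : (α s₀ : X) ∈ δ)
    (hαneg : ∀ s, s < s₀ → (α s : X) ∉ δ ∧ sd 0 (α s) = -1)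
    (hαpos : ∀ s, s₀ < s → (α s : X) ∉ δ ∧ sd 0 (α s) = 1) :
    ¬ SimplyConnectedSpace X := by
  classical
  -- elementary set relations (`F = ⋂ l, S l`, `H_q = Trisection.spineHandlebody S q`)
  have hFH : ∀ q, (⋂ l, S l) ⊆ Trisection.spineHandlebody S q := fun q =>
    iInter_subset_spineHandlebody S q
  have hHc : ∀ q, IsClosed (Trisection.spineHandlebody S q) := fun q =>
    h.isClosed_spineHandlebody q
  have hFc : IsClosed (⋂ l, S l) := h.isCompact_iInter.isClosed
  haveI : CompactSpace X := h.compactSpace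
  have hδne : δ.Nonempty := hc.nonempty
  have hδF : δ ⊆ (⋂ l, S l) := hc.1
  have hδD : ∀ q, δ ⊆ D q := fun q y hy => by
    have : y ∈ D q ∩ (⋂ l, S l) := by rw [hDF q]; exact hy
    exact this.1
  have hDne : ∀ q, (D q).Nonempty := fun q => hδne.mono (hδD q)
  have hnotD : ∀ q, ∀ y ∈ (⋂ l, S l), y ∉ δ → y ∉ D q := fun q y hyF hyδ hyD => by
    have : y ∈ D q ∩ (⋂ l, S l) := ⟨hyD, hyF⟩
    rw [hDF q] at this
    exact hyδ this
  -- a metric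
  haveI : TopologicalSpace.MetrizableSpace X := Manifold.metrizableSpace (𝓡 4) X
  letI : MetricSpace X := TopologicalSpace.metrizableSpaceMetric X
  -- the normal coordinates `K_q = σ_q · infDist(·, D_q)`
  set K : Fin 3 → X → ℝ := fun q y => sd q y * infDist y (D q) with hK
  have hK0 : ∀ q, ∀ y ∈ D q, K q y = 0 := fun q y hy => by
    simp only [hK, infDist_zero_of_mem hy, mul_zero]
  have hKabs : ∀ q, ∀ y ∈ O q ∩ Trisection.spineHandlebody S q, |K q y| ≤ infDist y (D q) :=
      fun q y hy => by
    by_cases hyD : y ∈ D q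
    · rw [hK0 q y hyD, abs_zero]; exact infDist_nonneg
    · obtain ⟨hv, -⟩ := hsd q y ⟨hy, hyD⟩
      simp only [hK, abs_mul, abs_of_nonneg infDist_nonneg]
      rcases hv with h1 | h1 <;> simp [h1]
  have hDpos : ∀ q, ∀ y, y ∉ D q → 0 < infDist y (D q) := fun q y hyD =>
    ((hDc q).notMem_iff_infDist_pos (hDne q)).1 hyD
  have hKne : ∀ q, ∀ y ∈ O q ∩ Trisection.spineHandlebody S q, y ∉ D q → K q y ≠ 0 :=
      fun q y hy hyD => by
    obtain ⟨hv, -⟩ := hsd q y ⟨hy, hyD⟩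
    have hpos := hDpos q y hyD
    rcases hv with h1 | h1 <;> simp [hK, h1, hpos.ne']
  -- continuity of `K_q` on `O_q ∩ H_q`, relative to `H_q`
  have hKcont : ∀ q, ContinuousOn (K q) (O q ∩ (Trisection.spineHandlebody S q)) := by
    intro q y hy
    refine ContinuousWithinAt.mono ?_ inter_subset_right
    by_cases hyD : y ∈ D q
    · -- `K → 0 = K y`
      show Tendsto (K q) (𝓝[(Trisection.spineHandlebody S q)] y) (𝓝 (K q y))
      rw [hK0 q y hyD, Metric.tendsto_nhds]
      intro ε hε
      have h1 : ∀ᶠ z in 𝓝[Trisection.spineHandlebody S q] y,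
          z ∈ O q ∩ Trisection.spineHandlebody S q :=
        Filter.inter_mem (mem_nhdsWithin_of_mem_nhds ((hO q).mem_nhds hy.1)) self_mem_nhdsWithin
      have h2 : ∀ᶠ z in 𝓝[(Trisection.spineHandlebody S q)] y, dist z y < ε :=
        mem_nhdsWithin_of_mem_nhds (Metric.ball_mem_nhds y hε)
      filter_upwards [h1, h2] with z hz1 hz2
      rw [Real.dist_eq, sub_zero]
      exact lt_of_le_of_lt ((hKabs q z hz1).trans (infDist_le_dist_of_mem hyD)) hz2
    · -- `σ_q` is locally constant and `infDist` is continuous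
      obtain ⟨-, hloc⟩ := hsd q y ⟨hy, hyD⟩
      have h1 : ContinuousWithinAt (fun z => sd q y * infDist z (D q))
          (Trisection.spineHandlebody S q) y :=
        (continuous_const.mul (continuous_infDist_pt _)).continuousWithinAt
      refine h1.congr_of_eventuallyEq ?_ ?_
      · filter_upwards [hloc] with z hz
        simp only [hK, hz]
      · simp only [hK]
  -- the open set carrying the cut-off, and the closed set on which it is `1`
  set Ncut : Set X := {x | ∀ q, x ∈ Trisection.spineHandlebody S q → x ∈ O q} ∩
    {x | x ∈ (⋂ l, S l) → x ∈ A} with hNcut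
  have hNo : IsOpen Ncut := by
    have h1 : IsOpen {x : X | ∀ q, x ∈ Trisection.spineHandlebody S q → x ∈ O q} := by
      have : {x : X | ∀ q, x ∈ Trisection.spineHandlebody S q → x ∈ O q} =
          ⋂ q, ((Trisection.spineHandlebody S q)ᶜ ∪ O q) := by
        ext x; simp [imp_iff_not_or]
      rw [this]
      exact isOpen_iInter_of_finite fun q => (hHc q).isOpen_compl.union (hO q)
    have h2 : IsOpen {x : X | x ∈ (⋂ l, S l) → x ∈ A} := by
      have : {x : X | x ∈ (⋂ l, S l) → x ∈ A} = (⋂ l, S l)ᶜ ∪ A := by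
        ext x; simp only [mem_setOf_eq, mem_union, mem_compl_iff, imp_iff_not_or]
      rw [this]
      exact hFc.isOpen_compl.union hA
    exact h1.inter h2
  set P : Set X := (⋃ q, D q) ∪ range (fun s => (α s : X)) with hP
  have hPc : IsClosed P :=
    (isClosed_iUnion_of_finite hDc).union
      (isCompact_range (continuous_subtype_val.comp α.continuous)).isClosed
  have hPN : P ⊆ Ncut := by
    rintro y (hy | ⟨s, rfl⟩)
    · obtain ⟨q', hyq'⟩ := mem_iUnion.1 hy
      refine ⟨fun q hyq => ?_, fun hyF => hδA ?_⟩
      · by_cases hqq : q = q'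
        · subst hqq; exact hDO q hyq'
        · have hyF : y ∈ (⋂ l, S l) :=
            spineHandlebody_inter_spineHandlebody_subset S hqq ⟨hyq, hDH q' hyq'⟩
          exact hDO q (hδD q (by rw [← hDF q']; exact ⟨hyq', hyF⟩))
      · rw [← hDF q']; exact ⟨hyq', hyF⟩
    · exact ⟨fun q _ => hAO q (hαA s), fun _ => hαA s⟩
  obtain ⟨ρ, hsupp, ⟨U1, -, hPU1, hρ1⟩, -⟩ := exists_cutoff_nhdsSet hPc hNo hPN
  have hU1N : U1 ⊆ Ncut := fun y hy =>
    hsupp (subset_tsupport ρ (by rw [mem_support, hρ1 y hy]; exact one_ne_zero))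
  -- the three collapses on the handlebodies
  have hNq : ∀ q, IsOpen (Subtype.val ⁻¹' O q : Set ↥(Trisection.spineHandlebody S q)) := fun q =>
    (hO q).preimage continuous_subtype_val
  have hKq : ∀ q, ContinuousOn (K q ∘ Subtype.val)
      (Subtype.val ⁻¹' O q : Set ↥(Trisection.spineHandlebody S q)) := fun q =>
    (hKcont q).comp continuous_subtype_val.continuousOn fun y hy => ⟨hy, y.2⟩
  have hKneq : ∀ q, ∀ y ∈ (Subtype.val ⁻¹' O q : Set ↥(Trisection.spineHandlebody S q)),
      y ∉ (Subtype.val ⁻¹' D q : Set ↥(Trisection.spineHandlebody S q)) →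
      (K q ∘ Subtype.val) y ≠ 0 := fun q y hy hyD => hKne q y ⟨hy, y.2⟩ hyD
  have hρq : ∀ q, Continuous (ρ ∘ (Subtype.val : ↥(Trisection.spineHandlebody S q) → X)) :=
    fun q => ρ.continuous.comp continuous_subtype_val
  have hsuppq : ∀ q, tsupport (ρ ∘ (Subtype.val : ↥(Trisection.spineHandlebody S q) → X)) ⊆
      Subtype.val ⁻¹' O q := fun q y hy =>
    (hsupp (tsupport_comp_subtype_val_subset ρ hy)).1 q y.2
  have hρPq : ∀ q, ∀ y ∈ (Subtype.val ⁻¹' D q : Set ↥(Trisection.spineHandlebody S q)),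
      (ρ ∘ Subtype.val) y ≠ 0 := fun q y hy => by
    show ρ y.1 ≠ 0
    rw [hρ1 _ (hPU1 (Or.inl (mem_iUnion.2 ⟨q, hy⟩)))]
    exact one_ne_zero
  set Θ : ∀ q : Fin 3, C(↥((Trisection.spineHandlebody S q)), AddCircle (1 : ℝ)) := fun q =>
    circleCollapseMap (hNq q) (hKq q) (hKneq q) (hρq q) (hsuppq q) (hρPq q) with hΘ
  -- the collapse `c` of `δ` in `(⋂ l, S l)`: the trace of `Θ_0`
  have hNF : IsOpen (Subtype.val ⁻¹' A : Set ↥(⋂ l, S l)) := hA.preimage continuous_subtype_val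
  have hKF : ∀ q, ContinuousOn (K q ∘ Subtype.val) (Subtype.val ⁻¹' A : Set ↥(⋂ l, S l)) :=
    fun q => (hKcont q).comp continuous_subtype_val.continuousOn fun y hy => ⟨hAO q hy, hFH q y.2⟩
  have hKneF : ∀ q, ∀ y ∈ (Subtype.val ⁻¹' A : Set ↥(⋂ l, S l)),
      y ∉ (Subtype.val ⁻¹' δ : Set ↥(⋂ l, S l)) → (K q ∘ Subtype.val) y ≠ 0 := fun q y hy hyδ =>
    hKne q y ⟨hAO q hy, hFH q y.2⟩ (hnotD q y y.2 hyδ)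
  have hK0F : ∀ y ∈ (Subtype.val ⁻¹' δ : Set ↥(⋂ l, S l)), (K 0 ∘ Subtype.val) y = 0 := fun y hy =>
    hK0 0 y (hδD 0 hy)
  have hρF : Continuous (ρ ∘ (Subtype.val : ↥(⋂ l, S l) → X)) :=
    ρ.continuous.comp continuous_subtype_val
  have hsuppF : tsupport (ρ ∘ (Subtype.val : ↥(⋂ l, S l) → X)) ⊆ Subtype.val ⁻¹' A := fun y hy =>
    (hsupp (tsupport_comp_subtype_val_subset ρ hy)).2 y.2
  have hρPF : ∀ y ∈ (Subtype.val ⁻¹' δ : Set ↥(⋂ l, S l)), (ρ ∘ Subtype.val) y ≠ 0 :=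
      fun y hy => by
    show ρ y.1 ≠ 0
    rw [hρ1 _ (hPU1 (Or.inl (mem_iUnion.2 ⟨0, hδD 0 hy⟩)))]
    exact one_ne_zero
  set c : C(↥(⋂ l, S l), AddCircle (1 : ℝ)) :=
    circleCollapseMap hNF (hKF 0) (hKneF 0) hρF hsuppF hρPF with hcdef
  -- the winding character of `c` at the base point `a`
  set w : FundamentalGroup ↥(⋂ l, S l) a →* Multiplicative ℤ :=
    (fundamentalGroupAddCircleEquiv one_ne_zero (c a)).toMonoidHom.comp (FundamentalGroup.map c a)
    with hw
  refine h.not_simplyConnectedSpace_of_hom_spineHandlebody a.2 w (fun q => ?_) ?_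
  · -- `w` vanishes on `ker (π₁ F → π₁ H_q)`: the trace of `Θ_q` is `± c + [real]`
    set cq : C(↥(⋂ l, S l), AddCircle (1 : ℝ)) :=
      (Θ q).comp (ContinuousMap.inclusion (hFH q)) with hcq
    have hker := ker_inclHomOfSubset_le_ker_windingHom (hFH q) a.2 (hFH q a.2) (Θ q) cq rfl
    have hcq_apply : ∀ y : ↥(⋂ l, S l), cq y =
        circleCollapse (K q ∘ (Subtype.val : ↥(⋂ l, S l) → X)) (ρ ∘ Subtype.val) y := fun y => rfl
    have hc_apply : ∀ y : ↥(⋂ l, S l), c y =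
        circleCollapse (K 0 ∘ (Subtype.val : ↥(⋂ l, S l) → X)) (ρ ∘ Subtype.val) y := fun y => rfl
    have heq : ((fundamentalGroupAddCircleEquiv one_ne_zero (cq a)).toMonoidHom.comp
        (FundamentalGroup.map cq a)).ker = w.ker := by
      rcases hcomp q with hq | hq
      · -- same sides on `(A ∩ (⋂ l, S l)) ∖ δ`
        have hsign : ∀ y ∈ (Subtype.val ⁻¹' A : Set ↥(⋂ l, S l)),
            y ∉ (Subtype.val ⁻¹' δ : Set ↥(⋂ l, S l)) →
            0 < (K q ∘ Subtype.val) y * (K 0 ∘ Subtype.val) y := fun y hy hyδ => by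
          have hs := hq y ⟨⟨hy, y.2⟩, hyδ⟩
          obtain ⟨hv, -⟩ := hsd 0 y ⟨⟨hAO 0 hy, hFH 0 y.2⟩, hnotD 0 y y.2 hyδ⟩
          have h1 : 0 < infDist (y : X) (D q) := hDpos q y (hnotD q y y.2 hyδ)
          have h2 : 0 < infDist (y : X) (D 0) := hDpos 0 y (hnotD 0 y y.2 hyδ)
          show 0 < sd q y * infDist (y : X) (D q) * (sd 0 y * infDist (y : X) (D 0))
          rw [hs]
          rcases hv with h0 | h0 <;> rw [h0] <;> nlinarith
        refine ker_windingHom_eq_of_eq_add_coe cq c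
          (continuous_collapseDiff hNF (hKF q) (hKF 0) hsign hρF hsuppF hρPF) (fun y => ?_) a
        rw [hcq_apply, hc_apply]
        exact circleCollapse_eq_circleCollapse_add_coe _ _ _ y
      · -- opposite sides on `(A ∩ (⋂ l, S l)) ∖ δ`: compare `K_q` with `-K_0`
        have hsign : ∀ y ∈ (Subtype.val ⁻¹' A : Set ↥(⋂ l, S l)),
            y ∉ (Subtype.val ⁻¹' δ : Set ↥(⋂ l, S l)) →
            0 < (K q ∘ Subtype.val) y * (fun z => -(K 0 ∘ Subtype.val) z) y := fun y hy hyδ => by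
          have hs := hq y ⟨⟨hy, y.2⟩, hyδ⟩
          obtain ⟨hv, -⟩ := hsd 0 y ⟨⟨hAO 0 hy, hFH 0 y.2⟩, hnotD 0 y y.2 hyδ⟩
          have h1 : 0 < infDist (y : X) (D q) := hDpos q y (hnotD q y y.2 hyδ)
          have h2 : 0 < infDist (y : X) (D 0) := hDpos 0 y (hnotD 0 y y.2 hyδ)
          show 0 < sd q y * infDist (y : X) (D q) * -(sd 0 y * infDist (y : X) (D 0))
          rw [hs]
          rcases hv with h0 | h0 <;> rw [h0] <;> nlinarith
        refine ker_windingHom_eq_of_eq_neg_add_coe cq c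
          (continuous_collapseDiff hNF (hKF q) (hKF 0).neg hsign hρF hsuppF hρPF) (fun y => ?_) a
        rw [hcq_apply, hc_apply, ← circleCollapse_neg_left]
        exact circleCollapse_eq_circleCollapse_add_coe _ _ _ y
    rw [← heq]
    exact hker
  · -- `w ≠ 1`: the crossing arc closed up by a path in `F ∖ δ` has winding number `+1`
    have h0lt : (0 : I) < s₀ := Subtype.coe_lt_coe.1 hs₀.1
    have hlt1 : s₀ < (1 : I) := Subtype.coe_lt_coe.1 hs₀.2
    have ha : (a : X) ∉ δ := by
      have := (hαneg 0 h0lt).1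
      rwa [α.source] at this
    have hb : (b : X) ∉ δ := by
      have := (hαpos 1 hlt1).1
      rwa [α.target] at this
    -- the return path in `(⋂ l, S l) ∖ δ`
    obtain ⟨β, hβ⟩ := h.exists_path_diff_of_isNonSeparating hc hns ⟨b.2, hb⟩ ⟨a.2, ha⟩
    have hVN : (Subtype.val ⁻¹' U1 : Set ↥(⋂ l, S l)) ⊆ Subtype.val ⁻¹' A := fun y hy =>
      (hU1N hy).2 y.2
    have hV1 : ∀ y ∈ (Subtype.val ⁻¹' U1 : Set ↥(⋂ l, S l)), (ρ ∘ Subtype.val) y = 1 := fun y hy =>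
      hρ1 _ hy
    have hαV : ∀ s, α s ∈ (Subtype.val ⁻¹' U1 : Set ↥(⋂ l, S l)) := fun s =>
      hPU1 (Or.inr ⟨s, rfl⟩)
    have hα0' : (K 0 ∘ Subtype.val) (α s₀) = 0 := hK0 0 _ (hδD 0 hα₀)
    have hαneg' : ∀ s, s < s₀ → (K 0 ∘ Subtype.val) (α s) < 0 := fun s hs => by
      obtain ⟨hsδ, hss⟩ := hαneg s hs
      have hpos := hDpos 0 (α s) (hnotD 0 _ (α s).2 hsδ)
      show sd 0 (α s) * infDist ((α s : X)) (D 0) < 0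
      rw [hss]; linarith
    have hαpos' : ∀ s, s₀ < s → 0 < (K 0 ∘ Subtype.val) (α s) := fun s hs => by
      obtain ⟨hsδ, hss⟩ := hαpos s hs
      have hpos := hDpos 0 (α s) (hnotD 0 _ (α s).2 hsδ)
      show 0 < sd 0 (α s) * infDist ((α s : X)) (D 0)
      rw [hss, one_mul]; exact hpos
    have hβ' : ∀ s, β s ∉ (Subtype.val ⁻¹' δ : Set ↥(⋂ l, S l)) := fun s => hβ s
    exact (windingHom_circleCollapse_ne_one_of_arc_of_path hNF (hKF 0) (hKneF 0) hK0F hρF hsuppF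
      hρPF hVN hV1 α β hαV s₀ hα0' hαneg' hαpos' hβ').1

end Literature.Topology.FourManifolds

end
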